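import Literature.Analysis.PDE.SymmetricHyperbolicRegularised
import HarnessLib

/-!
# Friedrichs' method, the differentiated equation: the Leibniz expansion of `∂_v (𝒫U)`, the derived
# coefficients `∂_a Aⱼ, ∂_a B`, and the smooth representatives `ρ ⋆ Y` of `L²` fields
# (topic `Analysis/PDE`)

Analytic layer of the energy-method existence theory for linear first-order symmetric hyperbolic
systems `∂ₜU = 𝒫(t)U = Σⱼ Aⱼ(t) ∂ⱼU + B(t) U` (Friedrichs 1954), built to discharge the named
fact `Literature.Geometry.Lorentzian.KerrSchild.waveCauchyProblem`. The a-priori bounds of every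
order for Friedrichs' regularised solutions `U_ε' = J_ε 𝒫 J_ε U_ε` (`SymmetricHyperbolicRegularised`)
are obtained from the **differentiated equations** satisfied by the (unmollified) word
derivatives; this file provides the three ingredients of those equations:

* `cwd_foOp` — the **Leibniz expansion** `∂_v (𝒫_{A,B} U) = Σ_{(a,c) ∈ splittings v} 𝒫_{∂_aA, ∂_aB} (∂_c U)`
  for smooth coefficients and fields (from the tree's `cwd_bilinear`);
* `IsRegularSymmCoeffFamily` — admissible symmetric coefficients (`IsSymmCoeffFamily`) which are
  moreover jointly smooth and whose spatial word derivatives of every order are Lipschitz in time,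
  uniformly in space, on compact time intervals; for them the **derived coefficients**
  `(∂_aAⱼ(t), ∂_aB(t))` are bounded coefficient data (`isBddCoeff_cwd`) with bounds uniform on
  compact time intervals (`exists_bound_cwd_coeff`) and Lipschitz in time (`lipk`);
* `smoothRep` — the **smooth representative** `ρ ⋆ ⇑Y` of `Y ∈ L²` for a smooth compactly supported
  kernel: smooth, with `∂_u(ρ ⋆ Y) = (∂_uρ) ⋆ Y` square integrable (`‖∂_u(ρ ⋆ Y)‖₂ ≤ ‖∂_uρ‖₁ ‖Y‖₂`)
  and bounded (`‖∂_u(ρ ⋆ Y)(x)‖ ≤ ‖∂_uρ‖₂ ‖Y‖₂`), hence `H^k`-smooth of every order;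
* `derivedOp` — the bounded operators `Y ↦ 𝒫_{∂_aA(s), ∂_aB(s)} ((∂_cρ) ⋆ Y)` on `L²` (the tree's
  `opL2` with derived coefficients and derivative kernels), their representatives, bounds uniform
  on compact time intervals and continuity in time along continuous `L²`-valued curves.

Everything is proved; no named fact and no `sorry` is introduced.

## References

* K. O. Friedrichs, *Symmetric hyperbolic linear differential equations*, Comm. Pure Appl. Math.
  7 (1954) 345–392, §§1–4. [Friedrichs1954]
* M. E. Taylor, *Partial Differential Equations III*, 2nd ed., Springer 2011, Ch. 16, §1.
  [TaylorPDEIII2011]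
-/

noncomputable section

open MeasureTheory Set Function Filter Metric ContinuousLinearMap
open scoped ContDiff Topology RealInnerProductSpace ENNReal NNReal Convolution

namespace Literature.Analysis.PDE

open Literature.Analysis.FunctionSpaces

variable {ι : Type*} [Fintype ι]
variable {W : Type*} [NormedAddCommGroup W] [InnerProductSpace ℝ W]

/-! ### Interchanging a finite sum with a sum over a list -/

omit [Fintype ι] in
/-- `Σ_{j ∈ s} Σ_{p ∈ l} h j p = Σ_{p ∈ l} Σ_{j ∈ s} h j p` for a list `l`. [folklore] -/
theorem finset_sum_list_sum_map {κ M : Type*} [AddCommMonoid M] {α : Type*} (s : Finset κ)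
    (l : List α) (h : κ → α → M) :
    ∑ j ∈ s, (l.map (h j)).sum = (l.map fun p ↦ ∑ j ∈ s, h j p).sum := by
  induction l with
  | nil => simp
  | cons a l ih => simp [Finset.sum_add_distrib, ih]

/-! ### The Leibniz expansion of `∂_v (𝒫U)` -/

section Leibniz

variable {A : ι → EuclideanSpace ℝ ι → (W →L[ℝ] W)} {B : EuclideanSpace ℝ ι → (W →L[ℝ] W)}

/-- **The Leibniz expansion of a word derivative of `𝒫U`**: for smooth coefficients and a smooth
field, `∂_v (Σⱼ Aⱼ ∂ⱼU + B U) = Σ_{(a,c) ∈ splittings v} (Σⱼ (∂_aAⱼ) ∂ⱼ(∂_cU) + (∂_aB)(∂_cU))`, i.e.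
`∂_v (𝒫_{A,B} U) = Σ_{(a,c)} 𝒫_{∂_aA, ∂_aB} (∂_cU)`. [cite: Friedrichs1954, §4] -/
theorem cwd_foOp (hA : ∀ j, ContDiff ℝ ∞ (A j)) (hB : ContDiff ℝ ∞ B) {U : EuclideanSpace ℝ ι → W}
    (hU : ContDiff ℝ ∞ U) (v : List ι) :
    cwd v (foOp A B U) = fun x ↦
      ((splittings v).map fun p ↦ foOp (fun j ↦ cwd p.1 (A j)) (cwd p.1 B) (cwd p.2 U) x).sum := by
  have hdU : ∀ j, ContDiff ℝ ∞ fun y ↦ fderiv ℝ U y (bv j) := fun j ↦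
    (hU.fderiv_right (m := ∞) le_rfl).clm_apply contDiff_const
  have hterm : ∀ j, ContDiff ℝ ∞ fun x ↦ A j x (fderiv ℝ U x (bv j)) := fun j ↦
    (hA j).clm_apply (hdU j)
  have hfo : foOp A B U = fun x ↦ (∑ j, A j x (fderiv ℝ U x (bv j))) + B x (U x) := rfl
  rw [hfo, cwd_fun_add (ContDiff.sum fun j _ ↦ hterm j) (hB.clm_apply hU),
    cwd_finset_sum _ (fun j _ ↦ hterm j)]
  have hj : ∀ j, cwd v (fun x ↦ A j x (fderiv ℝ U x (bv j))) = fun x ↦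
      ((splittings v).map fun p ↦ cwd p.1 (A j) x (fderiv ℝ (cwd p.2 U) x (bv j))).sum := by
    intro j
    have h := cwd_bilinear (applyCLM W) (hA j) (hdU j) v
    simp only [applyCLM_apply] at h
    rw [h]
    funext x
    congr 1
    refine List.map_congr_left fun p _ ↦ ?_
    rw [cwd_fderiv_eq_fderiv_cwd hU]
  have hb : cwd v (fun x ↦ B x (U x)) = fun x ↦
      ((splittings v).map fun p ↦ cwd p.1 B x (cwd p.2 U x)).sum := by
    have h := cwd_bilinear (applyCLM W) hB hU v
    simp only [applyCLM_apply] at h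
    exact h
  funext x
  simp only [hj, hb]
  rw [finset_sum_list_sum_map, ← List.sum_map_add]
  rfl

end Leibniz

/-! ### Regular admissible coefficient families and their derived coefficients -/

section Family

variable {A : ι → ℝ → EuclideanSpace ℝ ι → (W →L[ℝ] W)} {B : ℝ → EuclideanSpace ℝ ι → (W →L[ℝ] W)}

/-- **Regular admissible symmetric coefficients**: admissible symmetric coefficients
(`IsSymmCoeffFamily`) which are jointly `C^∞` in `(t, x)` and all of whose spatial word derivatives
are Lipschitz in time, uniformly in space, on compact time intervals (Friedrichs 1954, §1:
coefficients with bounded derivatives of all orders). [cite: Friedrichs1954, §1] -/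
structure IsRegularSymmCoeffFamily (A : ι → ℝ → EuclideanSpace ℝ ι → (W →L[ℝ] W))
    (B : ℝ → EuclideanSpace ℝ ι → (W →L[ℝ] W)) : Prop extends IsSymmCoeffFamily A B where
  /-- Joint smoothness of the `Aⱼ`. -/
  jointA : ∀ j, ContDiff ℝ ∞ fun p : ℝ × EuclideanSpace ℝ ι ↦ A j p.1 p.2
  /-- Joint smoothness of `B`. -/
  jointB : ContDiff ℝ ∞ fun p : ℝ × EuclideanSpace ℝ ι ↦ B p.1 p.2
  /-- Lipschitz continuity in time of the word derivatives of every order, uniformly in space. -/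
  lipk : ∀ (T : ℝ) (k : ℕ), ∃ L, 0 ≤ L ∧ ∀ s ∈ Icc (-T) T, ∀ t ∈ Icc (-T) T, ∀ x,
    (∀ (j : ι) (v : List ι), v.length ≤ k → ‖cwd v (A j t) x - cwd v (A j s) x‖ ≤ L * |t - s|) ∧
    (∀ v : List ι, v.length ≤ k → ‖cwd v (B t) x - cwd v (B s) x‖ ≤ L * |t - s|)

namespace IsRegularSymmCoeffFamily

variable (h : IsRegularSymmCoeffFamily A B)
include h

/-- The frozen `Aⱼ(t, ·)` are smooth. [cite: Friedrichs1954, §1] -/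
theorem contDiff_A (j : ι) (t : ℝ) : ContDiff ℝ ∞ (A j t) := by
  obtain ⟨M, hM⟩ := h.exists_coeff t 0
  exact hM.smoothA j

/-- The frozen `B(t, ·)` is smooth. [cite: Friedrichs1954, §1] -/
theorem contDiff_B (t : ℝ) : ContDiff ℝ ∞ (B t) := by
  obtain ⟨M, hM⟩ := h.exists_coeff t 0
  exact hM.smoothB

/-- A bound of the word derivatives of the frozen coefficients of order `k` at time `t`
(a definite choice). [folklore] -/
def boundk (t : ℝ) (k : ℕ) : ℝ := Classical.choose (h.exists_coeff t k)

/-- The defining property of `boundk`. [folklore] -/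
theorem isSymmCoeff_boundk (t : ℝ) (k : ℕ) : IsSymmCoeff k (h.boundk t k) (fun j ↦ A j t) (B t) :=
  Classical.choose_spec (h.exists_coeff t k)

/-- **The derived coefficients `(∂_aAⱼ(t), ∂_aB(t))` of a word `a` are bounded coefficient data**
(continuous, with operator norms bounded by the order-`|a|` bound). [cite: Friedrichs1954, §1] -/
theorem isBddCoeff_cwd (t : ℝ) (a : List ι) :
    IsBddCoeff (h.boundk t a.length) (fun j ↦ cwd a (A j t)) (cwd a (B t)) where
  contA j := (contDiff_cwd (h.contDiff_A j t) a).continuous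
  contB := (contDiff_cwd (h.contDiff_B t) a).continuous
  nonneg := (h.isSymmCoeff_boundk t a.length).nonneg
  boundA j x := (h.isSymmCoeff_boundk t a.length).boundA j a (Nat.le_succ _) x
  boundB x := (h.isSymmCoeff_boundk t a.length).boundB a le_rfl x

/-- **Uniform bounds for the derived coefficients on compact time intervals.**
[cite: Friedrichs1954, §1] -/
theorem exists_isBddCoeff_cwd (T : ℝ) (k : ℕ) :
    ∃ M, 0 ≤ M ∧ ∀ t ∈ Icc (-T) T, ∀ a : List ι, a.length ≤ k →
      IsBddCoeff M (fun j ↦ cwd a (A j t)) (cwd a (B t)) := by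
  obtain ⟨M, hM⟩ := h.coeff T k
  refine ⟨max M 0, le_max_right _ _, fun t ht a ha ↦ ⟨fun j ↦ (contDiff_cwd (h.contDiff_A j t) a).continuous,
    (contDiff_cwd (h.contDiff_B t) a).continuous, le_max_right _ _, fun j x ↦ ?_, fun x ↦ ?_⟩⟩
  · exact ((hM t ht).boundA j a (by omega) x).trans (le_max_left _ _)
  · exact ((hM t ht).boundB a ha x).trans (le_max_left _ _)

end IsRegularSymmCoeffFamily

end Family

/-! ### Smooth representatives of `L²` fields -/

section SmoothRep

variable {ρ : EuclideanSpace ℝ ι → ℝ}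

/-- The **smooth representative** `ρ ⋆ ⇑Y` of `Y ∈ L²(ℝⁿ; W)` for a kernel `ρ`.
[cite: Friedrichs1954, §3] -/
def smoothRep (ρ : EuclideanSpace ℝ ι → ℝ) (Y : Lp W 2 (volume : Measure (EuclideanSpace ℝ ι))) :
    EuclideanSpace ℝ ι → W :=
  ρ ⋆[lsmul ℝ ℝ, volume] (Y : EuclideanSpace ℝ ι → W)

/-- Unfolding of `smoothRep`. [cite: Friedrichs1954, §3] -/
theorem smoothRep_def (ρ : EuclideanSpace ℝ ι → ℝ) (Y : Lp W 2 (volume : Measure (EuclideanSpace ℝ ι))) :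
    smoothRep ρ Y = ρ ⋆[lsmul ℝ ℝ, volume] (Y : EuclideanSpace ℝ ι → W) := rfl

/-- The smooth representative is smooth. [cite: Friedrichs1954, §3] -/
theorem contDiff_smoothRep (hρ : ContDiff ℝ ∞ ρ) (hρc : HasCompactSupport ρ)
    (Y : Lp W 2 (volume : Measure (EuclideanSpace ℝ ι))) : ContDiff ℝ ∞ (smoothRep ρ Y) :=
  contDiff_convolution_kernel hρ hρc ((Lp.memLp Y).locallyIntegrable one_le_two)

/-- **Word derivatives of the smooth representative fall on the kernel**: `∂_u (ρ ⋆ Y) = (∂_uρ) ⋆ Y`.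
[cite: Friedrichs1954, §3] -/
theorem cwd_smoothRep (hρ : ContDiff ℝ ∞ ρ) (hρc : HasCompactSupport ρ)
    (Y : Lp W 2 (volume : Measure (EuclideanSpace ℝ ι))) (u : List ι) :
    cwd u (smoothRep ρ Y) = smoothRep (cwd u ρ) Y :=
  cwd_convolution_eq_convolution_cwd_kernel hρ hρc ((Lp.memLp Y).locallyIntegrable one_le_two) u

/-- The smooth representative is square integrable with `‖ρ ⋆ Y‖₂ ≤ ‖ρ‖₁ ‖Y‖₂`.
[cite: Friedrichs1954, §3] -/
theorem memLp_smoothRep (hρ : Continuous ρ) (hρc : HasCompactSupport ρ)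
    (Y : Lp W 2 (volume : Measure (EuclideanSpace ℝ ι))) :
    MemLp (smoothRep ρ Y) 2 (volume : Measure (EuclideanSpace ℝ ι)) ∧
      l2norm (smoothRep ρ Y) ≤ (∫ y, |ρ y|) * ‖Y‖ := by
  have h := memLp_convolution_kernel hρ hρc (Lp.memLp Y)
  rw [Lp.norm_def, ← l2norm_def]
  exact h

/-- **Every word derivative of the smooth representative is square integrable**, with
`‖∂_u(ρ ⋆ Y)‖₂ ≤ ‖∂_uρ‖₁ ‖Y‖₂`. [cite: Friedrichs1954, §3] -/
theorem memLp_cwd_smoothRep (hρ : ContDiff ℝ ∞ ρ) (hρc : HasCompactSupport ρ)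
    (Y : Lp W 2 (volume : Measure (EuclideanSpace ℝ ι))) (u : List ι) :
    MemLp (cwd u (smoothRep ρ Y)) 2 (volume : Measure (EuclideanSpace ℝ ι)) ∧
      l2norm (cwd u (smoothRep ρ Y)) ≤ (∫ y, |cwd u ρ y|) * ‖Y‖ := by
  rw [cwd_smoothRep hρ hρc]
  exact memLp_smoothRep (contDiff_cwd hρ u).continuous (hasCompactSupport_cwd hρc u) Y

/-- **Every word derivative of the smooth representative is bounded**:
`‖∂_u(ρ ⋆ Y)(x)‖ ≤ ‖∂_uρ‖₂ ‖Y‖₂`. [cite: Friedrichs1954, §3] -/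
theorem norm_cwd_smoothRep_le (hρ : ContDiff ℝ ∞ ρ) (hρc : HasCompactSupport ρ)
    (Y : Lp W 2 (volume : Measure (EuclideanSpace ℝ ι))) (u : List ι) (x : EuclideanSpace ℝ ι) :
    ‖cwd u (smoothRep ρ Y) x‖ ≤ l2norm (cwd u ρ) * ‖Y‖ := by
  have h := norm_cwd_convolution_kernel_apply_le hρ hρc (Lp.memLp Y) u x
  rw [Lp.norm_def, ← l2norm_def]
  exact h

/-- The smooth representative is `H^k`-smooth of every order. [cite: Friedrichs1954, §3] -/
theorem isHkSmooth_smoothRep (hρ : ContDiff ℝ ∞ ρ) (hρc : HasCompactSupport ρ)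
    (Y : Lp W 2 (volume : Measure (EuclideanSpace ℝ ι))) (k : ℕ) : IsHkSmooth k (smoothRep ρ Y) :=
  ⟨contDiff_smoothRep hρ hρc Y, fun u _ ↦ (memLp_cwd_smoothRep hρ hρc Y u).1⟩

/-- The value of `convL2 ρ` is represented by the smooth representative almost everywhere.
[folklore] -/
theorem coeFn_convL2_eq_smoothRep (hρ : Continuous ρ) (hρc : HasCompactSupport ρ)
    (Y : Lp W 2 (volume : Measure (EuclideanSpace ℝ ι))) :
    (convL2 ρ hρ hρc Y : EuclideanSpace ℝ ι → W) =ᵐ[(volume : Measure (EuclideanSpace ℝ ι))]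
      smoothRep ρ Y :=
  coeFn_convL2 hρ hρc Y

/-- `‖convL2 ρ Y‖ = ‖ρ ⋆ Y‖₂`. [folklore] -/
theorem norm_convL2_eq_l2norm_smoothRep (hρ : Continuous ρ) (hρc : HasCompactSupport ρ)
    (Y : Lp W 2 (volume : Measure (EuclideanSpace ℝ ι))) :
    ‖convL2 ρ hρ hρc Y‖ = l2norm (smoothRep ρ Y) :=
  norm_convL2_eq hρ hρc Y

omit [InnerProductSpace ℝ W] in
/-- **The `L²` element of a square-integrable continuous representative.** If `f ∈ L²` is the a.e.
representative of `F : Lp`, then `F = f` in `L²`. [folklore] -/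
theorem toLp_eq_of_coeFn_ae {f : EuclideanSpace ℝ ι → W}
    (hf : MemLp f 2 (volume : Measure (EuclideanSpace ℝ ι))) {F : Lp W 2 (volume : Measure (EuclideanSpace ℝ ι))}
    (hF : (F : EuclideanSpace ℝ ι → W) =ᵐ[(volume : Measure (EuclideanSpace ℝ ι))] f) :
    hf.toLp f = F := by
  rw [← Lp.toLp_coeFn F (Lp.memLp F)]
  exact (MemLp.toLp_congr _ _ hF).symm

/-- Smooth representatives of `L²`-close elements are uniformly close in every word derivative
(linearity and the sup bound). [cite: Friedrichs1954, §3] -/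
theorem smoothRep_sub (ρ : EuclideanSpace ℝ ι → ℝ) (hρ : Continuous ρ) (hρc : HasCompactSupport ρ)
    (Y Y' : Lp W 2 (volume : Measure (EuclideanSpace ℝ ι))) :
    smoothRep ρ (Y - Y') = smoothRep ρ Y - smoothRep ρ Y' := by
  have hY := Lp.memLp Y
  have hY' := Lp.memLp Y'
  have hexY : ConvolutionExists ρ (Y : EuclideanSpace ℝ ι → W) (lsmul ℝ ℝ) volume :=
    hρc.convolutionExists_left _ hρ (hY.locallyIntegrable one_le_two)
  have hexY' : ConvolutionExists ρ ((-1 : ℝ) • (Y' : EuclideanSpace ℝ ι → W)) (lsmul ℝ ℝ) volume :=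
    hρc.convolutionExists_left _ hρ ((hY'.const_smul (-1)).locallyIntegrable one_le_two)
  have hae : ((Y - Y' : Lp W 2 volume) : EuclideanSpace ℝ ι → W) =ᵐ[(volume : Measure (EuclideanSpace ℝ ι))]
      (Y : EuclideanSpace ℝ ι → W) + (-1 : ℝ) • (Y' : EuclideanSpace ℝ ι → W) := by
    filter_upwards [Lp.coeFn_sub Y Y'] with x hx
    rw [hx, Pi.add_apply, Pi.smul_apply, Pi.sub_apply, neg_one_smul, sub_eq_add_neg]
  rw [smoothRep, convolution_kernel_congr_ae hae, hexY.distrib_add hexY', convolution_smul, smoothRep,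
    smoothRep, neg_one_smul, sub_eq_add_neg]

end SmoothRep

/-! ### The derived operators on `L²` -/

section DerivedOp

variable {A : ι → ℝ → EuclideanSpace ℝ ι → (W →L[ℝ] W)} {B : ℝ → EuclideanSpace ℝ ι → (W →L[ℝ] W)}
variable (h : IsRegularSymmCoeffFamily A B) {ρ : EuclideanSpace ℝ ι → ℝ}
  (hρ : ContDiff ℝ ∞ ρ) (hρc : HasCompactSupport ρ)

/-- **The derived operator** `Y ↦ 𝒫_{∂_aA(s), ∂_aB(s)} ((∂_cρ) ⋆ Y)` on `L²(ℝⁿ; W)`: the term of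
the Leibniz expansion of `∂_v (𝒫(s) (ρ ⋆ Y))` belonging to the splitting `(a, c)` of `v`.
[cite: Friedrichs1954, §4] -/
def derivedOp (a c : List ι) (s : ℝ) :
    Lp W 2 (volume : Measure (EuclideanSpace ℝ ι)) →L[ℝ] Lp W 2 (volume : Measure (EuclideanSpace ℝ ι)) :=
  opL2 (fun j ↦ cwd a (A j s)) (cwd a (B s)) (h.isBddCoeff_cwd s a) (contDiff_cwd hρ c)
    (hasCompactSupport_cwd hρc c)

/-- The values of the derived operator are represented by `𝒫_{∂_aA(s), ∂_aB(s)} (∂_c (ρ ⋆ Y))`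
almost everywhere. [cite: Friedrichs1954, §4] -/
theorem coeFn_derivedOp (a c : List ι) (s : ℝ) (Y : Lp W 2 (volume : Measure (EuclideanSpace ℝ ι))) :
    (derivedOp h hρ hρc a c s Y : EuclideanSpace ℝ ι → W) =ᵐ[(volume : Measure (EuclideanSpace ℝ ι))]
      foOp (fun j ↦ cwd a (A j s)) (cwd a (B s)) (cwd c (smoothRep ρ Y)) := by
  rw [cwd_smoothRep hρ hρc]
  exact coeFn_opL2 _ _ _ Y

/-- **Uniform bound for the derived operators on compact time intervals**: for `|a| ≤ k`,
`‖derivedOp a c s Y‖ ≤ M_T Λ(∂_cρ) ‖Y‖` for `|s| ≤ T`. [cite: Friedrichs1954, §4] -/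
theorem exists_norm_derivedOp_le (T : ℝ) (k : ℕ) (c : List ι) :
    ∃ Λ, 0 ≤ Λ ∧ ∀ s ∈ Icc (-T) T, ∀ a : List ι, a.length ≤ k →
      ∀ Y : Lp W 2 (volume : Measure (EuclideanSpace ℝ ι)), ‖derivedOp h hρ hρc a c s Y‖ ≤ Λ * ‖Y‖ := by
  obtain ⟨M, hM0, hM⟩ := h.exists_isBddCoeff_cwd T k
  refine ⟨M * kernelConst (cwd c ρ), mul_nonneg hM0 (kernelConst_nonneg _), fun s hs a ha Y ↦ ?_⟩
  rw [derivedOp, norm_opL2_eq, Lp.norm_def, ← l2norm_def]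
  exact (memLp_foOp_convolution (hM s hs a ha) (contDiff_cwd hρ c) (hasCompactSupport_cwd hρc c)
    (Lp.memLp Y)).2

/-- **Lipschitz dependence on time of the derived operators** on compact time intervals:
`‖derivedOp a c t Y − derivedOp a c s Y‖ ≤ L_T Λ(∂_cρ) |t − s| ‖Y‖` for `|a| ≤ k`.
[cite: Friedrichs1954, §4] -/
theorem exists_norm_derivedOp_sub_le (T : ℝ) (k : ℕ) (c : List ι) :
    ∃ C, 0 ≤ C ∧ ∀ s ∈ Icc (-T) T, ∀ t ∈ Icc (-T) T, ∀ a : List ι, a.length ≤ k →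
      ∀ Y : Lp W 2 (volume : Measure (EuclideanSpace ℝ ι)),
        ‖derivedOp h hρ hρc a c t Y - derivedOp h hρ hρc a c s Y‖ ≤ C * |t - s| * ‖Y‖ := by
  obtain ⟨L, hL0, hL⟩ := h.lipk T k
  refine ⟨L * kernelConst (cwd c ρ), mul_nonneg hL0 (kernelConst_nonneg _), fun s hs t ht a ha Y ↦ ?_⟩
  have hη : 0 ≤ L * |t - s| := mul_nonneg hL0 (abs_nonneg _)
  have key := norm_opL2_sub_opL2_le (h.isBddCoeff_cwd t a) (h.isBddCoeff_cwd s a) (contDiff_cwd hρ c)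
    (hasCompactSupport_cwd hρc c) hη (fun j x ↦ (hL s hs t ht x).1 j a ha) (fun x ↦ (hL s hs t ht x).2 a ha) Y
  calc ‖derivedOp h hρ hρc a c t Y - derivedOp h hρ hρc a c s Y‖
        ≤ L * |t - s| * kernelConst (cwd c ρ) * ‖Y‖ := key
    _ = L * kernelConst (cwd c ρ) * |t - s| * ‖Y‖ := by ring

/-- **Continuity in time of the derived operators along a continuous `L²`-valued curve.**
[cite: Friedrichs1954, §4] -/
theorem continuous_derivedOp_apply (a c : List ι) {Y : ℝ → Lp W 2 (volume : Measure (EuclideanSpace ℝ ι))}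
    (hY : Continuous Y) : Continuous fun s ↦ derivedOp h hρ hρc a c s (Y s) := by
  refine continuous_iff_continuousAt.2 fun t₀ ↦ ?_
  obtain ⟨C, hC0, hC⟩ := exists_norm_derivedOp_sub_le h hρ hρc (|t₀| + 1) a.length c
  obtain ⟨Λ, hΛ0, hΛ⟩ := exists_norm_derivedOp_le h hρ hρc (|t₀| + 1) a.length c
  have ht₀ : t₀ ∈ Icc (-(|t₀| + 1)) (|t₀| + 1) := ⟨by linarith [neg_abs_le t₀], by linarith [le_abs_self t₀]⟩
  rw [ContinuousAt, tendsto_iff_norm_sub_tendsto_zero]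
  -- split `Op(t)(Y t) − Op(t₀)(Y t₀) = Op(t)(Y t − Y t₀) + (Op(t) − Op(t₀))(Y t₀)`
  have hbound : ∀ᶠ t in 𝓝 t₀, ‖derivedOp h hρ hρc a c t (Y t) - derivedOp h hρ hρc a c t₀ (Y t₀)‖ ≤
      Λ * ‖Y t - Y t₀‖ + C * |t - t₀| * ‖Y t₀‖ := by
    have hI : ∀ᶠ t in 𝓝 t₀, t ∈ Icc (-(|t₀| + 1)) (|t₀| + 1) := by
      filter_upwards [Icc_mem_nhds (show -(|t₀| + 1) < t₀ by linarith [neg_abs_le t₀])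
        (show t₀ < |t₀| + 1 by linarith [le_abs_self t₀])] with t ht using ht
    filter_upwards [hI] with t ht
    calc ‖derivedOp h hρ hρc a c t (Y t) - derivedOp h hρ hρc a c t₀ (Y t₀)‖
          = ‖derivedOp h hρ hρc a c t (Y t - Y t₀) +
              (derivedOp h hρ hρc a c t (Y t₀) - derivedOp h hρ hρc a c t₀ (Y t₀))‖ := by
            rw [map_sub]; congr 1; abel
      _ ≤ ‖derivedOp h hρ hρc a c t (Y t - Y t₀)‖ +
            ‖derivedOp h hρ hρc a c t (Y t₀) - derivedOp h hρ hρc a c t₀ (Y t₀)‖ := norm_add_le _ _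
      _ ≤ Λ * ‖Y t - Y t₀‖ + C * |t - t₀| * ‖Y t₀‖ :=
            add_le_add (hΛ t ht a le_rfl _) (hC t₀ ht₀ t ht a le_rfl _)
  have hlim : Tendsto (fun t ↦ Λ * ‖Y t - Y t₀‖ + C * |t - t₀| * ‖Y t₀‖) (𝓝 t₀) (𝓝 0) := by
    have h1 : Tendsto (fun t ↦ ‖Y t - Y t₀‖) (𝓝 t₀) (𝓝 0) := by
      have hc : Continuous fun t ↦ ‖Y t - Y t₀‖ := (hY.sub continuous_const).norm
      simpa using hc.tendsto t₀
    have h2 : Tendsto (fun t : ℝ ↦ |t - t₀|) (𝓝 t₀) (𝓝 0) := by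
      have hc : Continuous fun t : ℝ ↦ |t - t₀| := (continuous_id.sub continuous_const).abs
      simpa using hc.tendsto t₀
    simpa using (h1.const_mul Λ).add ((h2.const_mul C).mul_const ‖Y t₀‖)
  exact squeeze_zero' (Eventually.of_forall fun t ↦ norm_nonneg _) hbound hlim

end DerivedOp

end Literature.Analysis.PDE

end
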